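import Summits.CriticalPhenomena.PercolationContinuityZ3.Theorems.Transplant.KNCellsReach
import Summits.CriticalPhenomena.PercolationContinuityZ3.Theorems.Transplant.BoxProdZ2Defs
import HarnessLib

/-!
# F8 (generic), part 3e — what an occupied macro-vertex certifies, the envelope bound, and the ASSEMBLY of the five conjuncts of
# `SameP.SamePWitnessAt` for the anchored exploration process
# (BLUEPRINT-I-PHI §3 Φ13 'HSR instantiation'; generalises `L/KozmaNitzanTheorem6.lean` ll. 803–985 and p4's
# `PercNearOneGluingNoHeavySamePZd.lean` (`card_env_le`, the witness assembly) to an anchored cell geometry of a graph `G`)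

builds on p205010 (kernel theorem, internal audit signed; external expert review pending) — nothing in this file uses p205010.
Lane `prim-bschramm`, seat `prim-bschramm-p2` (task F8, lead V38: "the KSch-over-levels must produce exactly the five conjuncts of
`SameP.SamePWitnessAt`"); helper file (`--supports stmt-CriticalPhenomena-4575`).  Continuation of `KNCellsReach`.

* §1 `ExitGeom G Γ` — the last geometric facts: `M ⊆ Q`, cells of other macro-vertices and all zones miss every cube, and LOCAL FINITENESS
  of the edge regions seen from a vertex (a vertex is adjacent to `E_{w,v}` for boundedly many macro-targets `v`, whatever the anchors —
  KN: "within `16r` of the centre of `v`", `finite_setOf_near`);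
* §2 **`exists_exit`** — after a valid history the configuration itself has an open path inside the explored region from the root to a
  `G`-neighbour of `E_{w,v}` ((32) is a positive probability under the weighting pinned on the recorded pattern);
  **`mem_percolatesAt_of_infinite`** — an infinite macro-cluster forces an infinite open cluster of the root (the fifth conjunct);
* §3 **`card_env_le`** — after a valid history the envelope has at most `Δ · B` edges (`Δ` a degree bound, `B` a bound on the envelope
  regions: fresh edges touch the envelope region);
* §4 **`samePWitnessAt_of_cells`** — THE ASSEMBLY: an anchored cell geometry with `RunGeom`/`SepGeom`/`ExitGeom`, a degree bound, an
  envelope-region bound, `δ ≤ 1`, (32) at the root cell (`hQ0`, the scale choice) and the failure bound (33) after valid histories with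
  `ε < 2⁻³²` (`hfail`, the Steps files) give `SameP.SamePWitnessAt G root p`.
[cite: KozmaNitzan2024, §4 pp. 25–31 ((3), (32), proof of Theorem 6) — the ℤ^d model] [cite: GrimmettPercolation1999, §7.2]
-/

noncomputable section

open MeasureTheory ProbabilityTheory
open scoped ENNReal Classical

namespace Summit.CriticalPhenomena.PercolationContinuityZ3.Theorems

namespace Transplant

namespace KNCells

open Literature.Probability.Percolation Literature.Probability.LatticeModels SimpleGraph GadgetSystem ProbeHistory HSiteScheme Contour

variable {V : Type*} [DecidableEq V] [Countable V]

/-! ## §1 The last geometric facts -/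

/-- **The geometry of the certificate and of the counting argument** (KN pp. 26–27): targets inside cubes; cells of OTHER macro-vertices and
all stub zones miss every cube (whatever the anchors); and every vertex is adjacent to the edge regions `E_{w,v}` of boundedly many
macro-targets `v` (KN: such a vertex is within `16r` of `cen v`). [cite: KozmaNitzan2024, §4 pp. 26–27] -/
structure ExitGeom {A : Type*} (G : SimpleGraph V) (Γ : CellGeom V A) : Prop where
  M_subset_Q : ∀ a v, Γ.M a v ⊆ Γ.Q a v
  Cell_disjoint_Q : ∀ a a' u x, u ≠ x → Disjoint (Γ.Cell a u) (Γ.Q a' x)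
  Zone_disjoint_Q : ∀ a a' u δ x, Disjoint (Γ.Zone a u δ) (Γ.Q a' x)
  locFin : ∀ y : V, {v : Site 2 | ∃ (a : A) (w : Site 2) (δ : MDir), w + stepVec δ = v ∧ ∃ b ∈ Γ.Ewv a w δ, G.Adj y b}.Finite

namespace KSchA

variable {A : Type*} {G : SimpleGraph V} [G.LocallyFinite] {S : KSchA V A}
variable (hΓ : RunGeom G S.Γ) (hsep : SepGeom G S.Γ) (hX : ExitGeom G S.Γ) {ω : BondConfig V}
include hΓ hsep hX

/-! ## §2 What an occupied macro-vertex certifies -/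

omit [Countable V] hΓ hsep in
/-- The explored region of a valid history misses the cube of the target (any anchor). [cite: KozmaNitzan2024, §4 p. 26 ((29))] -/
theorem Valid.not_mem_Q_tgt {h : ProbeHistory V} {e : Site 2 × MDir} (hV : S.Valid G h e) {a : A} {y : V} (hy : y ∈ S.Vx G h) :
    y ∉ S.Γ.Q a (tgt e) := by
  obtain ⟨det, hv, -, hsub⟩ := hV.cover
  have hy' := hsub (Finset.mem_coe.2 hy)
  simp only [CellGeom.Cover, Set.mem_iUnion, Set.mem_union, exists_prop, Finset.mem_coe] at hy'
  obtain ⟨u, hu, h' | ⟨δ, h'⟩⟩ := hy'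
  · have hux : u ≠ tgt e := fun h'' => hv (h'' ▸ hu)
    exact Finset.disjoint_left.1 (hX.Cell_disjoint_Q _ _ _ _ hux) h'
  · exact Finset.disjoint_left.1 (hX.Zone_disjoint_Q _ _ _ _ _) h'

omit hsep in
/-- **The certificate of (32)** (KN p. 26, (3)): after a valid history the configuration itself has an open path inside the explored region
from the root to a `G`-neighbour of `E_{w,v}` (at the source's departure anchor) — (32) is a positive probability under the weighting pinned
on the recorded pattern, which on the initial event is the configuration's own. [cite: KozmaNitzan2024, §4 p. 26 ((3)) and p. 28 ((32))] -/
theorem exists_exit (hδc : S.δc ≤ 1) (hA : ω ∈ initEvent (S.scheme G))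
    {n : ℕ} {e : Site 2 × MDir} (hV : S.Valid G (S.hst G ω n) e) :
    ∃ a ∈ S.Vx G (S.hst G ω n), PathIn (openGraph ω) (↑(S.Vx G (S.hst G ω n)) : Set V) S.Γ.root a ∧
      ∃ b ∈ S.Γ.Ewv (S.aOf G (S.hst G ω n) e) e.1 e.2, G.Adj a b := by
  set aa := S.aOf G (S.hst G ω n) e with haa
  set W := S.W₀ G (S.hst G ω n) e aa with hW
  have hI := runInv hΓ ω n
  have hpos : 0 < (prodBernoulli W).real (⋃ t ∈ S.Γ.M aa (tgt e), openConn S.Γ.root t) :=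
    lt_of_le_of_lt (by linarith) hV.reach
  -- almost surely no pair of weight zero is open
  have hae : ∀ᵐ η ∂prodBernoulli W, ∀ x ∈ {x : Sym2 V | W x = 0}, x ∉ η :=
    prodBernoulli_ae_forall_notMem _ (Set.to_countable _) fun x hx => hx
  have hne : ((⋃ t ∈ S.Γ.M aa (tgt e), openConn S.Γ.root t) ∩ {η | ∀ x : Sym2 V, W x = 0 → x ∉ η}).Nonempty := by
    by_contra h
    rw [Set.not_nonempty_iff_eq_empty] at h
    have h1 : (prodBernoulli W).real ((⋃ t ∈ S.Γ.M aa (tgt e), openConn S.Γ.root t) ∩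
        {η | ∀ x : Sym2 V, W x = 0 → x ∉ η}) = (prodBernoulli W).real (⋃ t ∈ S.Γ.M aa (tgt e), openConn S.Γ.root t) := by
      refine measureReal_congr ?_
      filter_upwards [hae] with η hη
      exact propext ⟨fun h' => h'.1, fun h' => ⟨h', fun x hx => hη x hx⟩⟩
    rw [h, measureReal_empty] at h1
    linarith
  obtain ⟨η, hηA, hη0⟩ := hne
  simp only [Set.mem_iUnion, exists_prop] at hηA
  obtain ⟨t, ht, hreach⟩ := hηA
  have hopen : ∀ x y, (openGraph η).Adj x y → W s(x, y) ≠ 0 := fun x y hxy h0 =>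
    hη0 _ h0 ((openGraph_adj _ _ _).1 hxy).1
  -- the open path from the root to `M_v` inside `E_i ∪ E_{w,v}` and its first exit from `E_i`
  have hηwire : ∀ x ∈ η, x ∈ wireSet (↑(S.Vx G (S.hst G ω n) ∪ S.Γ.Ewv aa e.1 e.2) : Set V) := by
    intro x hx
    by_contra hxS
    exact hη0 x (by rw [hW, W₀]; exact restrW_apply_of_not_mem _ hxS) hx
  have hpath := pathIn_of_reachable_of_forall_mem_wireSet hηwire
    (Finset.mem_coe.2 (Finset.mem_union_left _ hV.root_mem)) hreach
  have htV : t ∉ (↑(S.Vx G (S.hst G ω n)) : Set V) := fun h =>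
    Valid.not_mem_Q_tgt hX hV (Finset.mem_coe.1 h) (hX.M_subset_Q _ _ ht)
  obtain ⟨a, b, ha, hb, hbU, hab, hpa⟩ := hpath.exit (R := (↑(S.Vx G (S.hst G ω n)) : Set V))
    (Finset.mem_coe.2 hV.root_mem) htV
  have hbE : b ∈ S.Γ.Ewv aa e.1 e.2 := by
    rcases Finset.mem_union.1 (Finset.mem_coe.1 hbU) with h | h
    · exact absurd (Finset.mem_coe.2 h) hb
    · exact h
  have haU : a ∈ (↑(S.Vx G (S.hst G ω n) ∪ S.Γ.Ewv aa e.1 e.2) : Set V) :=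
    Finset.mem_coe.2 (Finset.mem_union_left _ (Finset.mem_coe.1 ha))
  -- the exit edge is an edge of `G`
  have hab' : G.Adj a b := by
    have h1 := hopen a b hab
    rw [hW, W₀, restrW_apply_of_mem _ (mk_mem_wireSet_iff.2 ⟨haU, hbU, hab.ne⟩)] at h1
    have hF : s(a, b) ∉ (↑(S.F G (S.hst G ω n)) : Set (Sym2 V)) := by
      intro h
      rw [Finset.mem_coe, hI.F_eq, mem_edgesIn_iff] at h
      exact hb (Finset.mem_coe.2 (h.2 b (Sym2.mem_mk_right _ _)))
    rw [pinW_apply_of_not_mem _ _ hF] at h1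
    by_contra hnadj
    exact h1 (KNLevels.lattW_mk_of_not_adj G S.p hnadj)
  -- the initial segment is `ω`-open
  have hpa' : PathIn (openGraph ω) (↑(S.Vx G (S.hst G ω n)) : Set V) S.Γ.root a := by
    refine (DCT16.pathIn_congrGraph (fun x y hx hy hxy => ?_) hpa).mono Set.inter_subset_left
    have hxV : x ∈ S.Vx G (S.hst G ω n) := Finset.mem_coe.1 hx.1
    have hyV : y ∈ S.Vx G (S.hst G ω n) := Finset.mem_coe.1 hy.1
    have h1 := hopen x y hxy
    have hne := hxy.ne
    rw [hW, W₀, restrW_apply_of_mem _ (mk_mem_wireSet_iff.2 ⟨hx.2, hy.2, hne⟩)] at h1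
    by_cases hF : s(x, y) ∈ (↑(S.F G (S.hst G ω n)) : Set (Sym2 V))
    · have hξ : s(x, y) ∈ (↑(S.ξ G (S.hst G ω n)) : Set (Sym2 V)) := by
        by_contra hξ
        rw [pinW_apply_of_mem_of_not_mem _ hF hξ] at h1
        exact h1 rfl
      rw [openGraph_adj]
      rcases ((hI.ξ_iff _).1 (Finset.mem_coe.1 hξ)).2 with h | h
      · exact ⟨h, hne⟩
      · exact ⟨hA (Finset.mem_coe.2 h), hne⟩
    · exfalso
      rw [pinW_apply_of_not_mem _ _ hF] at h1
      by_cases hadj : G.Adj x y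
      · apply hF
        rw [Finset.mem_coe, hI.F_eq, mem_edgesIn_iff]
        refine ⟨(SimpleGraph.mem_edgeSet _).2 hadj, fun z hz => ?_⟩
        rcases Sym2.mem_iff.1 hz with rfl | rfl
        · exact hxV
        · exact hyV
      · exact h1 (KNLevels.lattW_mk_of_not_adj G S.p hadj)
  exact ⟨a, Finset.mem_coe.1 ha, hpa', b, hbE, hab'⟩

omit hsep in
/-- **An infinite macro-cluster forces an infinite open cluster of the root** (KN pp. 26–27: "the combination of (2) and (3)"): every
occupied macro-vertex `v ≠ 0` was examined after a valid history, whose certificate is a vertex of the root's cluster adjacent to the edge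
region `E_{w,v}`; a vertex is adjacent to the edge regions of boundedly many macro-targets. [cite: KozmaNitzan2024, §4 pp. 26–27] -/
theorem mem_percolatesAt_of_infinite (hδc : S.δc ≤ 1) (hA : ω ∈ initEvent (S.scheme G))
    (hinf : ((S.scheme G).occFinal ω).Infinite) : ω ∈ percolatesAt S.Γ.root := by
  set Cl := openCluster ω S.Γ.root with hCl
  have hnear : ∀ v ∈ (S.scheme G).occFinal ω, v ≠ 0 →
      ∃ y ∈ Cl, v ∈ {v : Site 2 | ∃ (a : A) (w : Site 2) (δ : MDir), w + stepVec δ = v ∧ ∃ b ∈ S.Γ.Ewv a w δ, G.Adj y b} := by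
    intro v hv hv0
    obtain ⟨n, hvn⟩ := Set.mem_iUnion.1 hv
    rcases (S.scheme G).exists_probe_of_det ω n v (Or.inl hvn) with h | ⟨m, -, e, P, hc, hte, hP, -⟩
    · exact absurd h hv0
    obtain ⟨e', hc', hV, rfl⟩ := S.of_next_some hP
    rw [hc] at hc'
    cases Option.some_injective _ hc'
    obtain ⟨y, -, hpa, b, hb, hyb⟩ := exists_exit hΓ hX hδc hA hV
    refine ⟨y, DCT16.reachable_of_pathIn hpa, ?_⟩
    exact ⟨S.aOf G (S.hst G ω m) e, e.1, e.2, hte, b, hb, hyb⟩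
  by_contra hfin
  have hClfin : Cl.Finite := Set.not_infinite.1 hfin
  have hF : (⋃ y ∈ Cl, {v : Site 2 | ∃ (a : A) (w : Site 2) (δ : MDir), w + stepVec δ = v ∧ ∃ b ∈ S.Γ.Ewv a w δ, G.Adj y b}).Finite :=
    hClfin.biUnion fun y _ => hX.locFin y
  refine hinf ((hF.union (Set.finite_singleton 0)).subset fun v hv => ?_)
  by_cases hv0 : v = 0
  · exact Or.inr hv0
  · obtain ⟨y, hy, hnr⟩ := hnear v hv hv0
    exact Or.inl (Set.mem_biUnion hy hnr)

/-! ## §3 The envelope bound -/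

omit [Countable V] hΓ hsep hX in
/-- **After a valid history the envelope of the examination has at most `Δ · B` edges**: the explored edges are exactly the edges of `G`
inside the explored region (`Valid.F_eq`), so a fresh edge of the envelope touches the envelope region, of at most `B` vertices.
[cite: KozmaNitzan2024, §4 p. 27 (E_{i+1})] -/
theorem card_env_le {Δ B : ℕ} (hΔ : ∀ x, G.degree x ≤ Δ)
    (hB : ∀ (h : ProbeHistory V) (e : Site 2 × MDir) (a : A), (S.envRegion G h e a).card ≤ B)
    {h : ProbeHistory V} {e : Site 2 × MDir} (hV : S.Valid G h e) (a : A) :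
    (S.env G h e a).card ≤ Δ * B := by
  have hsub : S.env G h e a ⊆ edgesTouching G (S.envRegion G h e a) := by
    intro x hx
    rw [KSchA.env, Finset.mem_sdiff, hV.F_eq] at hx
    obtain ⟨hx1, hx2⟩ := hx
    rw [mem_edgesIn_iff] at hx1 hx2
    rw [mem_edgesTouching_iff]
    refine ⟨hx1.1, ?_⟩
    by_contra hcon
    push Not at hcon
    exact hx2 ⟨hx1.1, fun z hz => (Finset.mem_union.1 (hx1.2 z hz)).resolve_right fun hzR => hcon z hzR hz⟩
  calc (S.env G h e a).card ≤ (edgesTouching G (S.envRegion G h e a)).card := Finset.card_le_card hsub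
    _ ≤ ∑ x ∈ S.envRegion G h e a, (G.incidenceFinset x).card := Finset.card_biUnion_le
    _ ≤ ∑ _x ∈ S.envRegion G h e a, Δ := Finset.sum_le_sum fun x _ => by
        rw [SimpleGraph.card_incidenceFinset_eq_degree]; exact hΔ x
    _ = Δ * (S.envRegion G h e a).card := by rw [Finset.sum_const, smul_eq_mul, mul_comm]
    _ ≤ Δ * B := Nat.mul_le_mul_left _ (hB h e a)

/-! ## §4 The assembly: the five conjuncts of `SameP.SamePWitnessAt` -/

/-- **THE ANCHORED EXPLORATION PROCESS IS A SAME-`p` WITNESS** (BLUEPRINT-I-PHI Φ13, the 'HSR instantiation'): given an anchored cell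
geometry of `G` with the run / separation / exit facts, a degree bound `Δ`, an envelope-region bound `B`, threshold `δ ≤ 1`, (32) at the
root cell (`hQ0`: the choice of the scale, KN p. 28) and the failure bound (33) after valid histories with `ε < 2⁻³²` (`hfail`: KN pp. 29–31,
the Steps files over cells), the scheme is a lawful history-driven site-renormalisation scheme with bounded envelopes, `U₀ ⊆ E(G)`, whose
infinite macro-cluster forces `root ↔ ∞` — i.e. `SameP.SamePWitnessAt G root p`. [cite: KozmaNitzan2024, §4 Theorem 6 (pp. 25–31)] -/
theorem samePWitnessAt_of_cells {Δ B : ℕ} (hΔ : ∀ x, G.degree x ≤ Δ)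
    (hB : ∀ (h : ProbeHistory V) (e : Site 2 × MDir) (a : A), (S.envRegion G h e a).card ≤ B)
    (hδc : S.δc ≤ 1) {ε : ℝ} (hε : ε < (1 / 2) ^ 32)
    (hQ0 : ∀ du : MDir, 1 - S.δc < (prodBernoulli (pinW (KNLevels.lattW G S.p) ↑(S.U₀ G) ↑(S.U₀ G))).real
      (⋃ t ∈ (↑(S.Γ.M S.Γ.a₀ ((0 : Site 2) + stepVec du)) : Set V),
        openConnIn (↑(S.Γ.Q S.Γ.a₀ 0 ∪ S.Γ.Ewv S.Γ.a₀ 0 du) : Set V) S.Γ.root t))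
    (hfail : ∀ h e, S.Valid G h e →
      (bondPercolation G S.p).real {ω | ¬S.succA G h e (S.aOf G h e) ((S.probe G h e (S.aOf G h e)).read ω)} ≤ ε) :
    SameP.SamePWitnessAt G S.Γ.root S.p := by
  refine ⟨S.scheme G, ε, Δ * B, lawful hΓ hsep hQ0 hfail, hε, ?_, fun x hx => (mem_edgesIn_iff.1 (Finset.mem_coe.1 hx)).1, ?_⟩
  · intro hh P hP
    rw [KSchA.scheme_next] at hP
    obtain ⟨e, -, hV, rfl⟩ := S.nextProbe_eq_some hP
    exact card_env_le hΔ hB hV _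
  · rintro ω' ⟨hA', hinf⟩
    exact Or.inl (mem_percolatesAt_of_infinite hΓ hX (ω := ω') hδc hA' hinf)

end KSchA

end KNCells

end Transplant

end Summit.CriticalPhenomena.PercolationContinuityZ3.Theorems

end
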